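import Literature.NumberTheory.Rogawski1990.SingularObstruction
import HarnessLib

/-!
# The singular obstruction VANISHES on globally represented classes: `x_g = t⋆ (y ⊗ 1) t` with `y ∈ Z(γ₀)(L)` global `⋆`-symmetric
# ⇒ `obs_s(p) = 0` — the `hvan` clause of the placewise singular ObsHasse socket (Rogawski 1990, §3.3 Prop. 3.3.1 (⇐) p. 22, §3.8 p. 37)

Topic `NumberTheory/Rogawski1990`; namespace `Literature.NumberTheory.Rogawski1990`; **THEOREMS ONLY** (no definition, no named fact, no instance,
no notation, no `sorry`).  Cell `pub/hodgecm-mathlib`, ENGINE T1 (crux H413 = `stmt-HodgeConjecture-24833`), O7 singular classes: first kernel-lane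
sequel of ★ `SingularObstruction` (`MatchingAdeleG₂.singularObs`).  It discharges, at `obs := singularObs hab hγ₀`, the hypothesis `hvan` of ★
`MatchingAdeleG₂.obsHasse_of_placewise` (`ObsHasseOfStepsSemisimple` ED. 2) TOKEN FOR TOKEN: if the adelic Cartan class of a conjugator `g` of `p` is
`x_g = t⋆ · (y ⊗ 1) · t` with `y ∈ M₃(L)` commuting with `γ₀`, `⋆`-symmetric and invertible, and `t ∈ Z(γ₀ ⊗ 1)(𝔸_L)`, then `obs_s(p) = 0` — because
`blockDet (x_g) = σ𝔸(c) · (blockDet_e y ⊗ 1) · c` with `c = blockDet t` (★ `blockDet_hermStar_mul_mul`) and `blockDet_e y ∈ L⁺ˣ` (`e⋆ = e` over `L`).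

* §1 `blockDet_map` (block determinants commute with ring maps); the RATIONAL Lagrange idempotent `e = (a − b)⁻¹(γ₀ − b) ∈ M₃(L)`: idempotent (★
  `isIdempotentElem_smul_sub_of_mul_sub_eq_zero`), `⋆`-self-adjoint (★ `hermAdjoint_lagrange_idem_eq`), `adelicLagrangeIdem = e ⊗ 1`.
* §2 **`MatchingAdeleG₂.singularObs_eq_zero_of_adelicCartan_eq`** = `hvan`.

## References
* [Rogawski1990] J. D. Rogawski, *Automorphic Representations of Unitary Groups in Three Variables*, Ann. of Math. Stud. 123 (1990), §3.3 Prop. 3.3.1 p. 22;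
  §3.8 Prop. 3.8.1 p. 37.
* [Kottwitz1986] R. E. Kottwitz, *Stable trace formula: elliptic singular terms*, Math. Ann. 275 (1986), §9.
-/

set_option autoImplicit false

noncomputable section

open NumberField IsDedekindDomain
open scoped Matrix MatrixGroups

namespace Literature.NumberTheory.Rogawski1990

open Literature.NumberTheory.Automorphic Literature.LinearAlgebra.Matrix
open Literature.AlgebraicGeometry.ShimuraVarieties (unitaryGroup mem_unitaryGroup_iff)

/-! ## §1 Block determinants under ring maps; the rational Lagrange idempotent -/

section Map

variable {R S : Type*} [CommRing R] [CommRing S] {n : Type*} [Fintype n] [DecidableEq n]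

/-- `blockDet` commutes with ring homomorphisms: `blockDet (f e) (f X) = f (blockDet e X)`. [cite: Rogawski1990, §3.8 p. 37] -/
theorem blockDet_map (f : R →+* S) (e X : Matrix n n R) : blockDet (e.map f) (X.map f) = f (blockDet e X) := by
  rw [blockDet_def, blockDet_def, RingHom.map_det, RingHom.mapMatrix_apply, Matrix.map_add _ (map_add f), Matrix.map_sub _ (map_sub f),
    Matrix.map_mul, Matrix.map_mul, Matrix.map_one f (map_zero f) (map_one f)]

end Map

section Rational

variable {L : Type} [Field L] [NumberField L] [IsCMField L] {H : Matrix (Fin 3) (Fin 3) L} {γ₀ : (UnitaryGroup.cmDatum L 3 H).Rational} {a b : L}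

/-- `adelicLagrangeIdem γ₀ a b = e ⊗ 1` for the RATIONAL Lagrange idempotent `e = (a − b)⁻¹ (γ₀ − b) ∈ M₃(L)`. [cite: Rogawski1990, §3.8 p. 37] -/
theorem adelicLagrangeIdem_eq_map (γ₀ : (UnitaryGroup.cmDatum L 3 H).Rational) (a b : L) :
    adelicLagrangeIdem γ₀ a b =
      ((a - b)⁻¹ • ((((γ₀ : unitaryGroup (cmConjRingHom L) H).val : GL (Fin 3) L) : Matrix (Fin 3) (Fin 3) L) - b • (1 : Matrix (Fin 3) (Fin 3) L))).map
        (algebraMap L (AdeleRing (𝓞 L) L)) :=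
  rfl

/-- The rational Lagrange idempotent is an idempotent. [cite: Rogawski1990, §3.8 p. 37] -/
theorem lagrangeIdem_mul_self (hab : a ≠ b)
    (hγ₀ : ((((γ₀ : unitaryGroup (cmConjRingHom L) H).val : GL (Fin 3) L) : Matrix (Fin 3) (Fin 3) L) - a • (1 : Matrix (Fin 3) (Fin 3) L)) *
      ((((γ₀ : unitaryGroup (cmConjRingHom L) H).val : GL (Fin 3) L) : Matrix (Fin 3) (Fin 3) L) - b • (1 : Matrix (Fin 3) (Fin 3) L)) = 0) :
    ((a - b)⁻¹ • ((((γ₀ : unitaryGroup (cmConjRingHom L) H).val : GL (Fin 3) L) : Matrix (Fin 3) (Fin 3) L) - b • (1 : Matrix (Fin 3) (Fin 3) L))) *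
        ((a - b)⁻¹ • ((((γ₀ : unitaryGroup (cmConjRingHom L) H).val : GL (Fin 3) L) : Matrix (Fin 3) (Fin 3) L) - b • (1 : Matrix (Fin 3) (Fin 3) L))) =
      (a - b)⁻¹ • ((((γ₀ : unitaryGroup (cmConjRingHom L) H).val : GL (Fin 3) L) : Matrix (Fin 3) (Fin 3) L) - b • (1 : Matrix (Fin 3) (Fin 3) L)) :=
  (isIdempotentElem_smul_sub_of_mul_sub_eq_zero (inv_mul_cancel₀ (sub_ne_zero.2 hab)) hγ₀).eq

/-- The rational Lagrange idempotent is `⋆`-SELF-ADJOINT for `H` (`γ₀` is `H`-unitary with unitary eigenvalues; ★ `hermAdjoint_lagrange_idem_eq`).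
[cite: Rogawski1990, §3.8 p. 37] [cite: Kottwitz1986, §7 Prop. 7.1] -/
theorem hermStar_lagrangeIdem (hHd : IsUnit H.det) (hab : a ≠ b) (ha : a * cmConjRingHom L a = 1) (hb : b * cmConjRingHom L b = 1)
    (hγ₀ : ((((γ₀ : unitaryGroup (cmConjRingHom L) H).val : GL (Fin 3) L) : Matrix (Fin 3) (Fin 3) L) - a • (1 : Matrix (Fin 3) (Fin 3) L)) *
      ((((γ₀ : unitaryGroup (cmConjRingHom L) H).val : GL (Fin 3) L) : Matrix (Fin 3) (Fin 3) L) - b • (1 : Matrix (Fin 3) (Fin 3) L)) = 0) :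
    hermStar (cmConjRingHom L) H
        ((a - b)⁻¹ • ((((γ₀ : unitaryGroup (cmConjRingHom L) H).val : GL (Fin 3) L) : Matrix (Fin 3) (Fin 3) L) - b • (1 : Matrix (Fin 3) (Fin 3) L))) =
      (a - b)⁻¹ • ((((γ₀ : unitaryGroup (cmConjRingHom L) H).val : GL (Fin 3) L) : Matrix (Fin 3) (Fin 3) L) - b • (1 : Matrix (Fin 3) (Fin 3) L)) := by
  rw [hermStar_def]
  exact hermAdjoint_lagrange_idem_eq (cmConjRingHom L) hHd (inv_mul_cancel₀ (sub_ne_zero.2 hab)) ha hb hγ₀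
    (mem_unitaryGroup_iff.1 (γ₀ : unitaryGroup (cmConjRingHom L) H).2)

end Rational

/-! ## §2 `hvan`: a globally represented adelic Cartan class has trivial singular obstruction -/

section Vanishing

variable {L : Type} [Field L] [NumberField L] [IsCMField L] {H : Matrix (Fin 3) (Fin 3) L} {γ₀ : (UnitaryGroup.cmDatum L 3 H).Rational} {a b : L}

/-- **`hvan` FOR THE SINGULAR OBSTRUCTION.**  Let `γ₀ ∈ U(H)(L⁺)` be split semisimple (`(γ₀ − a)(γ₀ − b) = 0`, `a ≠ b`, `a ā = b b̄ = 1`), `p` an adelic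
element of its stable class with adelic conjugator `g`.  If the adelic Cartan class is GLOBALLY represented, `x_g = t⋆ · (y ⊗ 1) · t` with
`y ∈ M₃(L)` commuting with `γ₀`, `⋆`-symmetric and invertible, and `t ∈ GL₃(𝔸_L)` commuting with `γ₀ ⊗ 1`, then `obs_s(p) = 0`: the block determinant
is `σ𝔸(c) · (k ⊗ 1) · c` with `c = blockDet (e ⊗ 1) t` an adelic unit and `k = blockDet e y ∈ L⁺ˣ` (★ `blockDet_hermStar_mul_mul`, `blockDet_map`,
`e⋆ = e`).  This is the hypothesis `hvan` of ★ `MatchingAdeleG₂.obsHasse_of_placewise` at `obs := singularObs hab hγ₀`, binders token for token.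
[cite: Rogawski1990, §3.3 Prop. 3.3.1 p. 22; §3.8 Prop. 3.8.1 (d) p. 37] [cite: Kottwitz1986, §9] -/
theorem MatchingAdeleG₂.singularObs_eq_zero_of_adelicCartan_eq (hHd : IsUnit H.det) (hab : a ≠ b)
    (ha : a * cmConjRingHom L a = 1) (hb : b * cmConjRingHom L b = 1)
    (hγ₀ : ((((γ₀ : unitaryGroup (cmConjRingHom L) H).val : GL (Fin 3) L) : Matrix (Fin 3) (Fin 3) L) - a • (1 : Matrix (Fin 3) (Fin 3) L)) *
      ((((γ₀ : unitaryGroup (cmConjRingHom L) H).val : GL (Fin 3) L) : Matrix (Fin 3) (Fin 3) L) - b • (1 : Matrix (Fin 3) (Fin 3) L)) = 0)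
    (p : MatchingAdeleG₂ L H H γ₀) (g : GL (Fin 3) (AdeleRing (𝓞 L) L)) (y : Matrix (Fin 3) (Fin 3) L) (t : GL (Fin 3) (AdeleRing (𝓞 L) L))
    (hg : g * (((UnitaryGroup.cmDatum L 3 H).toAdelic γ₀).val : GL (Fin 3) (AdeleRing (𝓞 L) L)) * g⁻¹ = (p.adele.val : GL (Fin 3) (AdeleRing (𝓞 L) L)))
    (hy : Commute y (((γ₀ : unitaryGroup (cmConjRingHom L) H).val : GL (Fin 3) L) : Matrix (Fin 3) (Fin 3) L))
    (hys : hermStar (cmConjRingHom L) H y = y) (hyu : IsUnit y.det)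
    (ht : t * (((UnitaryGroup.cmDatum L 3 H).toAdelic γ₀).val : GL (Fin 3) (AdeleRing (𝓞 L) L)) =
      (((UnitaryGroup.cmDatum L 3 H).toAdelic γ₀).val : GL (Fin 3) (AdeleRing (𝓞 L) L)) * t)
    (hx : (H.map (algebraMap L (AdeleRing (𝓞 L) L)))⁻¹ * twistGram (adeleConj L) (H.map (algebraMap L (AdeleRing (𝓞 L) L))) (g : Matrix (Fin 3) (Fin 3) (AdeleRing (𝓞 L) L)) =
      hermStar (adeleConj L) (H.map (algebraMap L (AdeleRing (𝓞 L) L))) (t : Matrix (Fin 3) (Fin 3) (AdeleRing (𝓞 L) L)) *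
        y.map (algebraMap L (AdeleRing (𝓞 L) L)) * (t : Matrix (Fin 3) (Fin 3) (AdeleRing (𝓞 L) L))) :
    p.singularObs hab hγ₀ = 0 := by
  set alg := algebraMap L (AdeleRing (𝓞 L) L) with halg
  set γM : Matrix (Fin 3) (Fin 3) L := (((γ₀ : unitaryGroup (cmConjRingHom L) H).val : GL (Fin 3) L) : Matrix (Fin 3) (Fin 3) L) with hγM
  set eL : Matrix (Fin 3) (Fin 3) L := (a - b)⁻¹ • (γM - b • (1 : Matrix (Fin 3) (Fin 3) L)) with heL
  have heA : adelicLagrangeIdem γ₀ a b = eL.map alg := rfl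
  have hγA : ((((UnitaryGroup.cmDatum L 3 H).toAdelic γ₀).val : GL (Fin 3) (AdeleRing (𝓞 L) L)) : Matrix (Fin 3) (Fin 3) (AdeleRing (𝓞 L) L)) = γM.map alg := rfl
  -- idempotency and self-adjointness, over `L` and over `𝔸_L`
  have heL2 : eL * eL = eL := lagrangeIdem_mul_self hab hγ₀
  have heLs : hermStar (cmConjRingHom L) H eL = eL := hermStar_lagrangeIdem hHd hab ha hb hγ₀
  have heA2 : adelicLagrangeIdem γ₀ a b * adelicLagrangeIdem γ₀ a b = adelicLagrangeIdem γ₀ a b := adelicLagrangeIdem_mul_self hab hγ₀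
  have heAs := hermStar_adelicLagrangeIdem hHd hab ha hb hγ₀
  -- commutation with the idempotent
  have hyeL : Commute y eL := (hy.sub_right ((Commute.one_right y).smul_right b)).smul_right _
  have htM : Commute ((t : Matrix (Fin 3) (Fin 3) (AdeleRing (𝓞 L) L)))
      ((((UnitaryGroup.cmDatum L 3 H).toAdelic γ₀).val : GL (Fin 3) (AdeleRing (𝓞 L) L)) : Matrix (Fin 3) (Fin 3) (AdeleRing (𝓞 L) L)) := by
    have h := congrArg (fun u : GL (Fin 3) (AdeleRing (𝓞 L) L) => (u : Matrix (Fin 3) (Fin 3) (AdeleRing (𝓞 L) L))) ht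
    simp only [Units.val_mul] at h
    exact h
  have hte : Commute ((t : Matrix (Fin 3) (Fin 3) (AdeleRing (𝓞 L) L))) (adelicLagrangeIdem γ₀ a b) := commute_adelicLagrangeIdem htM
  have hyA : Commute (y.map alg) (adelicLagrangeIdem γ₀ a b) := by
    rw [heA]
    change y.map alg * eL.map alg = eL.map alg * y.map alg
    rw [← Matrix.map_mul, ← Matrix.map_mul, hyeL.eq]
  -- the global factor `k = blockDet e y ∈ L⁺ˣ`
  have hk : IsUnit (blockDet eL y) := isUnit_blockDet heL2 hyeL hyu
  have hkc : cmConjRingHom L (blockDet eL y) = blockDet eL y := by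
    rw [← blockDet_hermStar (cmConjRingHom L) H hHd heLs, hys]
  -- the block determinant of `x_g`
  have hc : IsUnit (blockDet (adelicLagrangeIdem γ₀ a b) (t : Matrix (Fin 3) (Fin 3) (AdeleRing (𝓞 L) L))) :=
    isUnit_blockDet heA2 hte (Matrix.isUnits_det_units t)
  rw [p.singularObs_eq_zero_iff hHd hab ha hb hγ₀ hg, adelicBlockDet_def, hx,
    blockDet_hermStar_mul_mul (adeleConj L) _ (isUnit_det_adelicForm hHd) heA2 heAs hte hyA, heA, blockDet_map]
  refine ⟨blockDet eL y, hc.unit, hk.ne_zero, hkc, ?_⟩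
  rw [IsUnit.unit_spec, ← heA]
  ring

end Vanishing

end Literature.NumberTheory.Rogawski1990

end
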